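import Summits.Ventures.CertifiedQuantumChemistry.Certificates.HubbardRingL10U10055DQGKernelChunks1
import HarnessLib

/-!
# Ventures/CertifiedQuantumChemistry — Certificates/HubbardRingL10U10055DQGKernelChunks2.lean: KERNEL FACTS (chunks 6–9 of 48) of the dual SDP certificate for the v2RDM (DQG) LOWER row of `hubbardRingL10U100T` (sector (5,5))

HONEST FRAMING (verbatim): certified bounds for a stated model Hamiltonian in a stated basis; not a
claim about the real molecule beyond that model.

OFFERED FILE (pub-qchem-rdm = rdm-A, generation 71, 2026-08-26; ZERO compute: no kit job, no solver run — the cell's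
certificate of record was converted OFFLINE in exact rational arithmetic by stdlib Python (folder `work/ksdp/`, the converter
first re-derived byte-for-byte the landed N₂ literals of `Certificates/N2Sto6gRe*Kernel*.lean`), and every number below is
re-derived or checked by the kernel). The typer owns `Summits/…` and decides whether and where it lands.
CHECK EVIDENCE: {CHECK_EVIDENCE}

WHAT THIS FILE IS. Kernel facts only: certificate chunks 6–9 of 48 of `hubbardRingL10U10055DQG` (chunk 0 = the λ-scaled trace/contraction rows, chunks 1–3 = the whole-block batches, chunks 4–47 = the row slices of the 5 sliced blocks in order) —
each ONE `decide +kernel` equating the kernel-computed chunk output (constant, grouped canonical residual of `SCertS.chunkRows`) with its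
literal in `hubbardRingL10U10055DQG_R` (`Certificates/HubbardRingL10U10055DQGKernelChunks1.lean`). File 2 of 12
(split by kernel cost so that no single gate check is long); assembled with the merge stages and the theorem in `Certificates/HubbardRingL10U10055DQGKernelLower.lean`.
-/

namespace Summit.Ventures.CertifiedQuantumChemistry.Certificates

open V2RDMDual

-- KERNEL FACTS (one bounded kernel computation per chunk): the literals ARE the chunk outputs of the certificate.
set_option maxRecDepth 100000 in
set_option maxHeartbeats 4000000000 in
/-- KERNEL FACT, certificate chunk 6 of 48 (its own command, hence its own kernel budget; model cost ≈ 31.7 kernel-s). -/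
theorem hubbardRingL10U10055DQG_chunks_eq_6 :
    V2RDMDual.chunkOut (2 * 10) ((V2RDMDual.SCertS.chunkRows 10 5 5 hubbardRingL10U10055DQG).getD 6 (0, [])) = hubbardRingL10U10055DQG_R.getD 6 (0, []) := by
  decide +kernel

set_option maxRecDepth 100000 in
set_option maxHeartbeats 4000000000 in
/-- KERNEL FACT, certificate chunk 7 of 48 (its own command, hence its own kernel budget; model cost ≈ 31.8 kernel-s). -/
theorem hubbardRingL10U10055DQG_chunks_eq_7 :
    V2RDMDual.chunkOut (2 * 10) ((V2RDMDual.SCertS.chunkRows 10 5 5 hubbardRingL10U10055DQG).getD 7 (0, [])) = hubbardRingL10U10055DQG_R.getD 7 (0, []) := by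
  decide +kernel

set_option maxRecDepth 100000 in
set_option maxHeartbeats 4000000000 in
/-- KERNEL FACT, certificate chunk 8 of 48 (its own command, hence its own kernel budget; model cost ≈ 37.1 kernel-s). -/
theorem hubbardRingL10U10055DQG_chunks_eq_8 :
    V2RDMDual.chunkOut (2 * 10) ((V2RDMDual.SCertS.chunkRows 10 5 5 hubbardRingL10U10055DQG).getD 8 (0, [])) = hubbardRingL10U10055DQG_R.getD 8 (0, []) := by
  decide +kernel

set_option maxRecDepth 100000 in
set_option maxHeartbeats 4000000000 in
/-- KERNEL FACT, certificate chunk 9 of 48 (its own command, hence its own kernel budget; model cost ≈ 38.4 kernel-s). -/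
theorem hubbardRingL10U10055DQG_chunks_eq_9 :
    V2RDMDual.chunkOut (2 * 10) ((V2RDMDual.SCertS.chunkRows 10 5 5 hubbardRingL10U10055DQG).getD 9 (0, [])) = hubbardRingL10U10055DQG_R.getD 9 (0, []) := by
  decide +kernel

end Summit.Ventures.CertifiedQuantumChemistry.Certificates
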